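import Literature.AlgebraicGeometry.Resolution.GiraudLogJacobianIdeal
import Literature.AlgebraicGeometry.Resolution.ColengthOffCentre
import Literature.AlgebraicGeometry.Resolution.BlowupsFlatBaseChange
import Summits.ResolutionOfSingularities.ResolutionOfSingularities.Theorems.RadicialJungCleanModelsGiraudCoprincipalPart
import Mathlib.RingTheory.Ideal.Height
import HarnessLib

/-!
# Route `RadicialJung`, crux `CleanModels` (stmt-15917): Giraud's invariants are invariants —
# transport along ring isomorphisms and along local isomorphisms of schemes (T2 brick B6)

Support file (OURS) for PROGRAMME-clean-dim2 / T2 (`HOME/L/res-L0-w81-pv-2/g5/T2Skeleton.lean`,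
architecture `T2-ARCHITECTURE.md` §B6), line `via-clean-models` of crux `DescentPerfectToAll`
(stmt-0549). Nothing here is a statement of Hironaka's manuscript.

The T2 loop blows up ONE Giraud-singular point `ξ` of a stage `(X, f)`; off `ξ` the blow-up
`π : X₁ → X` is an isomorphism, so "nothing changes there". This file makes that precise for the
invariants of `Literature/AlgebraicGeometry/Resolution/GiraudLogJacobianIdeal.lean`:

* ring level, along a ring isomorphism `e : O ≃+* O'` carrying `f` to `e f`:
  `map_derivJacobianIdeal_ringEquiv` (`J(O', e f) = e J(O, f)`), `derivCriticalPrimes_ringEquiv`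
  (the critical primes correspond under `Ideal.map e`; `ncard_derivCriticalPrimes_ringEquiv`),
  `map_logDerivJacobianIdeal_ringEquiv`, `map_principalHullIdeal_ringEquiv`,
  `map_coprincipalPart_ringEquiv`, `giraudColength_ringEquiv` (`c(O', e f) = c(O, f)`);
* scheme level, at a point `x` of `X₁` where the stalk map of `π : X₁ → X` is an isomorphism
  (e.g. `π x ∈ U` with `π ∣_ U` an isomorphism, `isIso_stalkMap_of_isIso_morphismRestrict`):
  `mem_derivCriticalSet_iff_of_isIso_stalkMap`, `giraudColength_stalk_eq_of_isIso_stalkMap`,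
  `ncard_derivCriticalPrimes_stalk_eq_of_isIso_stalkMap`;
* `isGiraudSingularPoint_iff_of_isIso_morphismRestrict` — for `π ∣_ U` an isomorphism,
  `π x ∈ U`, `E(f₁) = π⁻¹ E(f)` (brick B2) with `E(f)` closed, and `π` a closed map:
  `x` is a Giraud-singular point of `(X₁, π^* f)` iff `π x` is one of `(X, f)`; together with
  `injOn_preimage_of_isIso_morphismRestrict'` these are hypotheses (i)/(ii) of the measure
  assembly lemma `T2.isDershowitzMannaLT_measure_of_fibre` (`…T2MeasureDecrease.lean`).

## References
* J. Giraud, Forme normale d'une fonction sur une surface de caractéristique positive,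
  Bull. SMF 111 (1983), 2.1–2.4. [Giraud1983]
-/

noncomputable section

set_option linter.dupNamespace false -- mandated namespace of this single-conjunct summit

open CategoryTheory AlgebraicGeometry TopologicalSpace IsLocalRing
open Literature.AlgebraicGeometry.Resolution

namespace Summit.ResolutionOfSingularities.ResolutionOfSingularities.Theorems.RadicialJung.CleanModels.T2

universe u

/-! ## Ring level: transport along a ring isomorphism -/

section Ring

variable {O O' : Type u} [CommRing O] [CommRing O'] (e : O ≃+* O')

/-- **Conjugating a derivation by a ring isomorphism**: for `D ∈ Der_ℤ(O)` there is
`D' ∈ Der_ℤ(O')` with `D' (e a) = e (D a)`. [folklore] -/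
theorem exists_derivation_ringEquiv_conj (D : Derivation ℤ O O) :
    ∃ D' : Derivation ℤ O' O', ∀ a, D' (e a) = e (D a) := by
  let L : O' →ₗ[ℤ] O' :=
    ((e : O →+* O').toAddMonoidHom.comp
      (D.toLinearMap.toAddMonoidHom.comp (e.symm : O' →+* O).toAddMonoidHom)).toIntLinearMap
  have hL : ∀ b, L b = e (D (e.symm b)) := fun b => rfl
  refine ⟨Derivation.mk' L fun a b => ?_, fun a => ?_⟩
  · rw [hL, hL, hL, map_mul, Derivation.leibniz, smul_eq_mul, smul_eq_mul, map_add, map_mul,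
      map_mul, e.apply_symm_apply, e.apply_symm_apply, smul_eq_mul, smul_eq_mul]
  · change L (e a) = e (D a)
    rw [hL, e.symm_apply_apply]

/-- The set of values `D f`, `D ∈ Der_ℤ`, is carried by `e` onto the corresponding set for
`e f`. [folklore] -/
theorem image_range_derivation_apply_ringEquiv (f : O) :
    e '' Set.range (fun D : Derivation ℤ O O => D f) =
      Set.range (fun D' : Derivation ℤ O' O' => D' (e f)) := by
  ext v
  constructor
  · rintro ⟨w, ⟨D, rfl⟩, rfl⟩
    obtain ⟨D', hD'⟩ := exists_derivation_ringEquiv_conj e D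
    exact ⟨D', hD' f⟩
  · rintro ⟨D', rfl⟩
    obtain ⟨D, hD⟩ := exists_derivation_ringEquiv_conj e.symm D'
    refine ⟨D f, ⟨D, rfl⟩, ?_⟩
    have h := hD (e f)
    rw [e.symm_apply_apply] at h
    simp only [h, e.apply_symm_apply]

/-- **`J(O', e f) = e · J(O, f)`** (Giraud's `J(X, f)`, derivation form, along a ring
isomorphism). [cite: Giraud1983, 1.1 (2)] -/
theorem map_derivJacobianIdeal_ringEquiv (f : O) :
    (derivJacobianIdeal O f).map e = derivJacobianIdeal O' (e f) := by
  unfold derivJacobianIdeal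
  rw [Ideal.map_span, image_range_derivation_apply_ringEquiv]

/-- `Ideal.map e` is injective for a ring isomorphism `e`. [folklore] -/
theorem map_injective_ringEquiv : Function.Injective (Ideal.map e : Ideal O → Ideal O') := by
  intro I J h
  have := congrArg (Ideal.map (e.symm : O' →+* O)) h
  rwa [← Ideal.map_coe e, ← Ideal.map_coe e, Ideal.map_of_equiv, Ideal.map_of_equiv] at this

/-- `I ≤ J ↔ e I ≤ e J` for a ring isomorphism `e`. [folklore] -/
theorem map_le_map_iff_ringEquiv (I J : Ideal O) : I.map e ≤ J.map e ↔ I ≤ J := by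
  refine ⟨fun h => ?_, fun h => Ideal.map_mono h⟩
  have := Ideal.map_mono (f := (e.symm : O' →+* O)) h
  rwa [← Ideal.map_coe e, ← Ideal.map_coe e, Ideal.map_of_equiv, Ideal.map_of_equiv] at this

/-- **The critical primes correspond** under a ring isomorphism: `P ↦ e P` is a bijection from
the height-one primes over `J(O, f)` onto those over `J(O', e f)`. [cite: Giraud1983, Déf. 1.2 (1)] -/
theorem derivCriticalPrimes_ringEquiv (f : O) :
    derivCriticalPrimes O' (e f) = Ideal.map e '' derivCriticalPrimes O f := by
  ext Q
  constructor
  · rintro ⟨hQ, hQh, hQJ⟩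
    refine ⟨Q.map (e.symm : O' →+* O), ⟨?_, ?_, ?_⟩, ?_⟩
    · exact Ideal.map_isPrime_of_equiv _
    · rw [Ideal.map_coe, RingEquiv.height_map]; exact hQh
    · have := Ideal.map_mono (f := (e.symm : O' →+* O)) hQJ
      rwa [← map_derivJacobianIdeal_ringEquiv e, ← Ideal.map_coe e, Ideal.map_of_equiv] at this
    · have := Ideal.map_of_equiv (I := Q) e.symm
      rwa [RingEquiv.symm_symm] at this
  · rintro ⟨P, ⟨hP, hPh, hPJ⟩, rfl⟩
    refine ⟨Ideal.map_isPrime_of_equiv _, ?_, ?_⟩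
    · rw [RingEquiv.height_map]; exact hPh
    · rw [← map_derivJacobianIdeal_ringEquiv e]; exact Ideal.map_mono hPJ

/-- Hence **the number of critical primes (branches of `E(f)` at the point) is invariant**.
[cite: Giraud1983, Déf. 1.2 (1)] -/
theorem ncard_derivCriticalPrimes_ringEquiv (f : O) :
    (derivCriticalPrimes O' (e f)).ncard = (derivCriticalPrimes O f).ncard := by
  rw [derivCriticalPrimes_ringEquiv e, Set.ncard_image_of_injective _ (map_injective_ringEquiv e)]

/-- A derivation preserving every critical prime of `f` is conjugated to one preserving every
critical prime of `e f`. [folklore] -/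
theorem image_setOf_logDerivation_apply_ringEquiv (f : O) :
    e '' {v : O | ∃ D : Derivation ℤ O O,
        (∀ P ∈ derivCriticalPrimes O f, ∀ a ∈ P, D a ∈ P) ∧ D f = v} =
      {v : O' | ∃ D' : Derivation ℤ O' O',
        (∀ Q ∈ derivCriticalPrimes O' (e f), ∀ b ∈ Q, D' b ∈ Q) ∧ D' (e f) = v} := by
  ext v
  constructor
  · rintro ⟨w, ⟨D, hDlog, rfl⟩, rfl⟩
    obtain ⟨D', hD'⟩ := exists_derivation_ringEquiv_conj e D
    refine ⟨D', fun Q hQ b hb => ?_, hD' f⟩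
    rw [derivCriticalPrimes_ringEquiv e] at hQ
    obtain ⟨P, hP, rfl⟩ := hQ
    obtain ⟨a, ha, rfl⟩ := (Ideal.mem_map_of_equiv e b).mp hb
    rw [hD']
    exact Ideal.mem_map_of_mem _ (hDlog P hP a ha)
  · rintro ⟨D', hD'log, rfl⟩
    obtain ⟨D, hD⟩ := exists_derivation_ringEquiv_conj e.symm D'
    refine ⟨D f, ⟨D, fun P hP a ha => ?_, rfl⟩, ?_⟩
    · have hQ : P.map e ∈ derivCriticalPrimes O' (e f) := by
        rw [derivCriticalPrimes_ringEquiv e]; exact ⟨P, hP, rfl⟩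
      have h1 := hD'log (P.map e) hQ (e a) (Ideal.mem_map_of_mem _ ha)
      have h2 : D a = e.symm (D' (e a)) := by
        have := hD (e a)
        rw [e.symm_apply_apply] at this
        exact this
      rw [h2]
      exact (Ideal.symm_apply_mem_of_equiv_iff).mpr h1
    · have h := hD (e f)
      rw [e.symm_apply_apply] at h
      rw [h, e.apply_symm_apply]

/-- **`J(O', e f, E) = e · J(O, f, E)`** (Giraud's log-Jacobian ideal, derivation form, along a
ring isomorphism). [cite: Giraud1983, 2.2 (1)] -/
theorem map_logDerivJacobianIdeal_ringEquiv (f : O) :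
    (logDerivJacobianIdeal O f).map e = logDerivJacobianIdeal O' (e f) := by
  unfold logDerivJacobianIdeal
  rw [Ideal.map_span, image_setOf_logDerivation_apply_ringEquiv]

/-- Principal ideals correspond under a ring isomorphism. [folklore] -/
theorem isPrincipal_map_ringEquiv_iff (I : Ideal O) : (I.map e).IsPrincipal ↔ I.IsPrincipal := by
  constructor
  · rintro ⟨⟨b, hb⟩⟩
    refine ⟨⟨e.symm b, ?_⟩⟩
    have := congrArg (Ideal.map (e.symm : O' →+* O)) hb
    rw [← Ideal.map_coe e, Ideal.map_of_equiv] at this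
    rw [this, Ideal.submodule_span_eq, Ideal.map_span, Set.image_singleton, Ideal.submodule_span_eq]
    rfl
  · rintro ⟨⟨a, ha⟩⟩
    refine ⟨⟨e a, ?_⟩⟩
    rw [ha, Ideal.submodule_span_eq, Ideal.map_span, Set.image_singleton, Ideal.submodule_span_eq]

/-- **`B(e I) = e B(I)`** (Giraud's principal hull along a ring isomorphism). [cite: Giraud1983, 2.1 (1)] -/
theorem map_principalHullIdeal_ringEquiv (I : Ideal O) :
    (principalHullIdeal I).map e = principalHullIdeal (I.map e) := by
  unfold principalHullIdeal
  rw [Ideal.map_sInf (f := e) e.surjective (fun J _ => by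
    rw [(RingHom.injective_iff_ker_eq_bot _).mp e.injective]; exact bot_le)]
  congr 1
  ext Q
  constructor
  · rintro ⟨P, ⟨hP, hIP⟩, rfl⟩
    exact ⟨(isPrincipal_map_ringEquiv_iff e P).mpr hP, Ideal.map_mono hIP⟩
  · rintro ⟨hQ, hIQ⟩
    refine ⟨Q.map (e.symm : O' →+* O), ⟨?_, ?_⟩, ?_⟩
    · rw [← Ideal.map_coe]; exact (isPrincipal_map_ringEquiv_iff e.symm Q).mpr hQ
    · have := Ideal.map_mono (f := (e.symm : O' →+* O)) hIQ
      rwa [← Ideal.map_coe e, Ideal.map_of_equiv] at this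
    · have := Ideal.map_of_equiv (I := Q) e.symm
      rwa [RingEquiv.symm_symm] at this

/-- **`D(e I) = e D(I)`** (Giraud's coprincipal part along a ring isomorphism). [cite: Giraud1983, 2.1 (2)] -/
theorem map_coprincipalPart_ringEquiv (I : Ideal O) :
    (coprincipalPart I).map e = coprincipalPart (I.map e) := by
  ext b
  rw [Ideal.mem_map_of_equiv, mem_coprincipalPart_iff, ← map_principalHullIdeal_ringEquiv]
  constructor
  · rintro ⟨a, ha, rfl⟩ c hc
    obtain ⟨d, hd, rfl⟩ := (Ideal.mem_map_of_equiv e c).mp hc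
    rw [← map_mul]
    exact Ideal.mem_map_of_mem _ (mem_coprincipalPart_iff.mp ha d hd)
  · intro h
    refine ⟨e.symm b, mem_coprincipalPart_iff.mpr fun d hd => ?_, e.apply_symm_apply b⟩
    have h1 := h (e d) (Ideal.mem_map_of_mem _ hd)
    have h2 : e.symm (b * e d) ∈ I := (Ideal.symm_apply_mem_of_equiv_iff).mpr h1
    rwa [map_mul, e.symm_apply_apply] at h2

/-- **`c(O', e f) = c(O, f)`**: Giraud's colength is invariant under ring isomorphisms.
[cite: Giraud1983, 2.1 (3)] -/
theorem giraudColength_ringEquiv (f : O) :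
    giraudColength O' (e f) = giraudColength O f := by
  unfold giraudColength
  rw [← map_logDerivJacobianIdeal_ringEquiv e, ← map_coprincipalPart_ringEquiv e,
    ← Ideal.map_coe e]
  exact length_quotient_map_eq_of_ringEquiv e _

/-- `J(O, f) ≤ 𝔪` is invariant under isomorphisms of local rings. [cite: Giraud1983, Déf. 1.2 (1)] -/
theorem derivJacobianIdeal_le_maximalIdeal_iff_ringEquiv [IsLocalRing O] [IsLocalRing O'] (f : O) :
    derivJacobianIdeal O' (e f) ≤ maximalIdeal O' ↔ derivJacobianIdeal O f ≤ maximalIdeal O := by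
  rw [← map_derivJacobianIdeal_ringEquiv e, ← map_ringEquiv_maximalIdeal e,
    map_le_map_iff_ringEquiv]

end Ring

/-! ## Scheme level: points where the stalk map is an isomorphism -/

section Scheme

variable {X₁ X : Scheme.{u}} (π : X₁ ⟶ X) (f : Γ(X, ⊤)) (x : X₁)

/-- The stalk isomorphism `𝒪_{X, π x} ≃ 𝒪_{X₁, x}` at a point where the stalk map is an
isomorphism carries the germ of `f` to the germ of `π^* f`. [folklore] -/
theorem stalkMap_ringEquiv_germ [IsIso (π.stalkMap x)] :
    (asIso (π.stalkMap x)).commRingCatIsoToRingEquiv (X.presheaf.germ ⊤ (π x) trivial f) =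
      X₁.presheaf.germ ⊤ x trivial (π.appTop f) := by
  change π.stalkMap x (X.presheaf.germ ⊤ (π x) trivial f) = _
  rw [Scheme.Hom.germ_stalkMap_apply]
  rfl

/-- **`x ∈ E(π^* f) ↔ π x ∈ E(f)`** at a point where the stalk map of `π` is an isomorphism.
[cite: Giraud1983, Déf. 1.2 (1)] -/
theorem mem_derivCriticalSet_iff_of_isIso_stalkMap [IsIso (π.stalkMap x)] :
    x ∈ derivCriticalSet X₁ (π.appTop f) ↔ π x ∈ derivCriticalSet X f := by
  change derivJacobianIdeal _ _ ≤ _ ↔ derivJacobianIdeal _ _ ≤ _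
  rw [← stalkMap_ringEquiv_germ π f x]
  exact derivJacobianIdeal_le_maximalIdeal_iff_ringEquiv _ _

/-- **`c(X₁, π^* f, x) = c(X, f, π x)`** at a point where the stalk map of `π` is an
isomorphism. [cite: Giraud1983, 2.2 (2)] -/
theorem giraudColength_stalk_eq_of_isIso_stalkMap [IsIso (π.stalkMap x)] :
    giraudColength (X₁.presheaf.stalk x) (X₁.presheaf.germ ⊤ x trivial (π.appTop f)) =
      giraudColength (X.presheaf.stalk (π x)) (X.presheaf.germ ⊤ (π x) trivial f) := by
  rw [← stalkMap_ringEquiv_germ π f x]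
  exact giraudColength_ringEquiv _ _

/-- **The number of branches of the critical set through the point is the same at `x` and at
`π x`** when the stalk map of `π` is an isomorphism. [cite: Giraud1983, Déf. 1.2 (1)] -/
theorem ncard_derivCriticalPrimes_stalk_eq_of_isIso_stalkMap [IsIso (π.stalkMap x)] :
    (derivCriticalPrimes (X₁.presheaf.stalk x) (X₁.presheaf.germ ⊤ x trivial (π.appTop f))).ncard =
      (derivCriticalPrimes (X.presheaf.stalk (π x)) (X.presheaf.germ ⊤ (π x) trivial f)).ncard := by
  rw [← stalkMap_ringEquiv_germ π f x]
  exact ncard_derivCriticalPrimes_ringEquiv _ _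

end Scheme

/-! ## Scheme level: where `π` restricts to an isomorphism over an open -/

section Restrict

variable {X₁ X : Scheme.{u}} (π : X₁ ⟶ X) (U : X.Opens) [IsIso (π ∣_ U)]

/-- If `π` is an isomorphism over the open `U`, then `π` is injective on `π⁻¹(U)` (hypothesis
(ii) of `isDershowitzMannaLT_measure_of_fibre` for `U = X ∖ {ξ}`). [folklore] -/
theorem injOn_preimage_of_isIso_morphismRestrict' : Set.InjOn π (π ⁻¹ᵁ U) := by
  intro a ha b hb hab
  have h1 : (π ∣_ U) ⟨a, ha⟩ = (π ∣_ U) ⟨b, hb⟩ := by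
    apply Subtype.ext
    rw [morphismRestrict_base_coe, morphismRestrict_base_coe]
    exact hab
  exact congrArg Subtype.val ((π ∣_ U).homeomorph.injective h1)

/-- If `π` is an isomorphism over the open `U` and `π x ∈ U`, the fibre of `π` through `x` is
`{x}`. [folklore] -/
theorem preimage_singleton_eq_of_isIso_morphismRestrict (x : X₁) (hx : π x ∈ U) :
    π ⁻¹' {π x} = {x} := by
  ext y
  simp only [Set.mem_preimage, Set.mem_singleton_iff]
  refine ⟨fun h => ?_, fun h => by rw [h]⟩
  have hy : π y ∈ U := by rw [h]; exact hx
  exact injOn_preimage_of_isIso_morphismRestrict' π U hy hx h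

/-- If `π` is an isomorphism over the open `U`, `π x ∈ U` and `{π x}` is closed, then `{x}` is
closed. [folklore] -/
theorem isClosed_singleton_of_isIso_morphismRestrict (x : X₁) (hx : π x ∈ U)
    (h : IsClosed ({π x} : Set X)) : IsClosed ({x} : Set X₁) := by
  rw [← preimage_singleton_eq_of_isIso_morphismRestrict π U x hx]
  exact h.preimage π.continuous

/-- The open immersion `π⁻¹(U) → X` obtained from an isomorphism `π ∣_ U`. -/
theorem isOpenImmersion_preimage_ι_comp_of_isIso_morphismRestrict :
    IsOpenImmersion ((π ⁻¹ᵁ U).ι ≫ π) := by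
  rw [← morphismRestrict_ι]
  infer_instance

/-- **The strict normal crossings condition at `x` for `π⁻¹ Z` is the condition at `π x` for
`Z`** when `π` is an isomorphism over an open `U ∋ π x` and `Z` is closed (transport along the
open immersions `π⁻¹(U) → X₁` and `π⁻¹(U) → X`). [folklore] -/
theorem isStrictNormalCrossingsAt_preimage_iff_of_isIso_morphismRestrict {Z : Set X}
    (hZ : IsClosed Z) (x : X₁) (hx : π x ∈ U) :
    IsStrictNormalCrossingsAt X₁ (π ⁻¹' Z) x ↔ IsStrictNormalCrossingsAt X Z (π x) := by
  haveI := isOpenImmersion_preimage_ι_comp_of_isIso_morphismRestrict π U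
  let y : ↥(π ⁻¹ᵁ U) := ⟨x, hx⟩
  have h1 := IsStrictNormalCrossingsAt.iff_of_isOpenImmersion ((π ⁻¹ᵁ U).ι ≫ π) hZ y
  have h2 := IsStrictNormalCrossingsAt.iff_of_isOpenImmersion (π ⁻¹ᵁ U).ι
    (hZ.preimage π.continuous) y
  have hy1 : ((π ⁻¹ᵁ U).ι ≫ π) y = π x := rfl
  have hy2 : (π ⁻¹ᵁ U).ι y = x := rfl
  rw [hy1] at h1
  rw [hy2] at h2
  rw [h1, h2]
  have : ((π ⁻¹ᵁ U).ι ≫ π : _ ⟶ X) ⁻¹' Z = ((π ⁻¹ᵁ U).ι) ⁻¹' (π ⁻¹' Z) := by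
    ext z; rfl
  rw [this]

/-- **Off the centre nothing changes.** Let `π : X₁ → X` be an isomorphism over the open `U`,
`x ∈ X₁` with `π x ∈ U`, and suppose `E(π^* f) = π⁻¹ E(f)` (brick B2) with `E(f)` closed. If
`{π x}` is closed then: `x` is a Giraud-singular point of `(X₁, π^* f)` iff `π x` is a
Giraud-singular point of `(X, f)`. [cite: Giraud1983, 2.2 (3)] -/
theorem isGiraudSingularPoint_iff_of_isIso_morphismRestrict_of_isClosed (f : Γ(X, ⊤)) (x : X₁)
    (hx : π x ∈ U) (hE : derivCriticalSet X₁ (π.appTop f) = π ⁻¹' derivCriticalSet X f)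
    (hEcl : IsClosed (derivCriticalSet X f)) (hcl : IsClosed ({π x} : Set X)) :
    IsGiraudSingularPoint X₁ (π.appTop f) x ↔ IsGiraudSingularPoint X f (π x) := by
  haveI := isIso_stalkMap_of_isIso_morphismRestrict π U x hx
  unfold IsGiraudSingularPoint
  rw [giraudColength_stalk_eq_of_isIso_stalkMap π f x, hE,
    isStrictNormalCrossingsAt_preimage_iff_of_isIso_morphismRestrict π U hEcl x hx,
    ← hE, mem_derivCriticalSet_iff_of_isIso_stalkMap π f x]
  exact ⟨fun h => ⟨hcl, h.2⟩,
    fun h => ⟨isClosed_singleton_of_isIso_morphismRestrict π U x hx hcl, h.2⟩⟩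

/-- **Off the centre nothing changes** (closed-map form, hypothesis (i) of the measure assembly
lemma). Let `π : X₁ → X` be a CLOSED map (e.g. proper) which is an isomorphism over the open
`U`, `x ∈ X₁` with `π x ∈ U`, and `E(π^* f) = π⁻¹ E(f)` with `E(f)` closed. Then `x` is a
Giraud-singular point of `(X₁, π^* f)` iff `π x` is a Giraud-singular point of `(X, f)`.
[cite: Giraud1983, 2.2 (3)] -/
theorem isGiraudSingularPoint_iff_of_isIso_morphismRestrict (hπ : IsClosedMap π)
    (f : Γ(X, ⊤)) (x : X₁) (hx : π x ∈ U)
    (hE : derivCriticalSet X₁ (π.appTop f) = π ⁻¹' derivCriticalSet X f)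
    (hEcl : IsClosed (derivCriticalSet X f)) :
    IsGiraudSingularPoint X₁ (π.appTop f) x ↔ IsGiraudSingularPoint X f (π x) := by
  constructor
  · intro h
    have hcl : IsClosed ({π x} : Set X) := by
      rw [← Set.image_singleton]; exact hπ _ h.1
    exact (isGiraudSingularPoint_iff_of_isIso_morphismRestrict_of_isClosed π U f x hx hE hEcl
      hcl).mp h
  · intro h
    exact (isGiraudSingularPoint_iff_of_isIso_morphismRestrict_of_isClosed π U f x hx hE hEcl
      h.1).mpr h

/-- **The entry data agree off the centre**: with `π ∣_ U` an isomorphism and `π x ∈ U`, the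
colength `c` and the number of branches at `x` (for `π^* f`) equal those at `π x` (for `f`), so
every function of them — in particular the skeleton's entry `2c + δ` — takes the same value.
[cite: Giraud1983, 2.2 (2)] -/
theorem giraudColength_and_ncard_eq_of_isIso_morphismRestrict (f : Γ(X, ⊤)) (x : X₁)
    (hx : π x ∈ U) :
    giraudColength (X₁.presheaf.stalk x) (X₁.presheaf.germ ⊤ x trivial (π.appTop f)) =
        giraudColength (X.presheaf.stalk (π x)) (X.presheaf.germ ⊤ (π x) trivial f) ∧
      (derivCriticalPrimes (X₁.presheaf.stalk x) (X₁.presheaf.germ ⊤ x trivial (π.appTop f))).ncard =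
        (derivCriticalPrimes (X.presheaf.stalk (π x)) (X.presheaf.germ ⊤ (π x) trivial f)).ncard := by
  haveI := isIso_stalkMap_of_isIso_morphismRestrict π U x hx
  exact ⟨giraudColength_stalk_eq_of_isIso_stalkMap π f x,
    ncard_derivCriticalPrimes_stalk_eq_of_isIso_stalkMap π f x⟩

end Restrict

end Summit.ResolutionOfSingularities.ResolutionOfSingularities.Theorems.RadicialJung.CleanModels.T2

end
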